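import Summits.Parity.GeneralizedHardyLittlewood.Theorems.LeeYangFibresCellParityLawKernelDefs
import Summits.Parity.GeneralizedHardyLittlewood.Theorems.LeeYangFibresCellParityLawDimension
import Summits.Parity.GeneralizedHardyLittlewood.Theorems.LeeYangFibresCellParityLawSingularRatio
import Summits.Parity.GeneralizedHardyLittlewood.Theorems.LeeYangFibresCellParityLawEulerRatio
import Literature.NumberTheory.Sieve.JurkatRichertRefutation
import Literature.NumberTheory.Sieve.LinearEquationsInPrimesLocalObstruction
import HarnessLib

/-!
# Route `LeeYangFibres`, crux `CellParityLaw` (stmt-Parity-14109), line `section-annihilator`: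
# the registered stub `stub_sectionDimensionLow` — the section densities from below

We prove `SectionDimensionLow` (vocabulary file `LeeYangFibresCellParityLawKernelDefs`, skeleton v13):
for every `t, L` there are `L₁ = 50 + 4(t+1)` and `N₀ = 8 + 2L + L(2L²)^t` such that for `N ≥ N₀`,
every non-degenerate system `Ψ = (ψ₀, …, ψ_t)` of one-dimensional forms `ψ_k(n) = a_k n + b_k` of
size `‖Ψ‖_N ≤ L` and every coordinate `i` whose section density `g = g_{Ψ,i} = sectionDensity Ψ i` has
no degenerate prime (`g(p) < 1` for all primes `p`):

* (a) `g(p) ≤ (t+2)/p` at every prime `p` (`g(p) ≤ 1/(p-t)` for `p > t` and `g(p) ≤ 1/2` always —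
  the landed `DimensionAux.sectionDensity_prime_le_inv` / `…_le_half`);
* (b) for `(log N)² ≤ w ≤ z ≤ 2LN`, `∏_{w ≤ p < z} (1 - g(p))⁻¹ ≥ (log z/log w)(1 - L₁/log w)`.

Proof of (b). Let `Δ = |a_i| ∏_{k ≠ i} |a_i b_k - a_k b_i|`, a non-zero integer (non-degeneracy,
`SingularRatio.crossDisc_ne_zero`) of size `≤ L(2L²N)^t ≤ N^{t+1}` (`SingularRatio.crossDisc_le`).
At a prime `p ∤ Δ` the root `-b_i/a_i` of `ψ_i` mod `p` is a zero of no other form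
(`SingularRatio.exists_root`), so with `G = goodCount Ψ p < G' = goodCount Ψ₋ᵢ p ≤ p` one has
`g(p) = (G' - G)/G' ≥ 1/p` (`EulerRatioAux.sectionDensity_prime`) and `(1 - g(p))⁻¹ ≥ (1 - 1/p)⁻¹`;
at a HOLE `p ∣ Δ` merely `(1 - g(p))⁻¹ ≥ 1 = (1 - 1/p)⁻¹ (1 - 1/p)` (`g(p) ≥ 0`). Hence
`∏_{w ≤ p < z} (1 - g(p))⁻¹ ≥ (Π(z)/Π(w)) ∏_{w ≤ p < z, p ∣ Δ} (1 - 1/p) ≥ (Π(z)/Π(w)) (1 - ω(Δ)/w)`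
(`Π(y) = ∏_{p<y} (1 - 1/p)⁻¹ = PairProducts.mertensProd y`, `PairProducts.prod_filter_eq_mertensProd_div`;
Weierstrass' inequality `∏ (1 - a_p) ≥ 1 - ∑ a_p` with `a_p = 1/p ≤ 1/w` at the at most `ω(Δ)` holes).
Now `2^{ω(Δ)} ≤ Δ ≤ N^{t+1}` gives `ω(Δ) ≤ 2(t+1) log N`, and `w ≥ (log N)²`,
`log w ≤ log z ≤ log(2LN) ≤ 2 log N` give `ω(Δ)/w ≤ 2(t+1)/log N ≤ 4(t+1)/log w`; Mertens' product
theorem with rate (`PairProducts.abs_log_mertensProd_sub_le`, twice) gives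
`Π(z)/Π(w) ≥ (log z/log w) e^{-50/log w} ≥ (log z/log w)(1 - 50/log w)`; finally
`(1 - a)(1 - b) ≥ 1 - a - b` for `a = 50/log w`, `b = 4(t+1)/log w` (if `1 - a - b ≤ 0` the claim is
trivial, the product being non-negative).

References: H. Iwaniec, *Rosser's sieve*, Acta Arith. 36 (1980), (1.2) (the two-sided condition
`Ω(κ, L)`) [IwaniecActaArith1980]; G. H. Hardy, E. M. Wright, Thm 429 (Mertens' product theorem)
[HardyWright2008]; B. Green, T. Tao, Ann. of Math. 171 (2010), proof of Lemma 1.3 (local counts off the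
exceptional primes) [GreenTao2010].
-/

noncomputable section

open scoped BigOperators Classical
open Finset Literature.NumberTheory.Sieve

namespace Summit.Parity.GeneralizedHardyLittlewood.Cruxes.CellParityLaw.SectionAnnihilator

namespace DimensionLowAux

variable {t : ℕ}

/-! ## (a) `g(p) ≤ (t+2)/p` -/

/-- Under `g(p) < 1`: `g(p) ≤ (t+2)/p` (for `p > t`: `g(p) ≤ 1/(p-t) ≤ (t+2)/p` as
`(t+1) p ≥ (t+1)² > t(t+2)`; for `p ≤ t`: `g(p) ≤ 1/2 ≤ (t+2)/p`). -/
theorem sectionDensity_prime_le_div (Ψ : Fin (t + 1) → AffLinForm 1) (i : Fin (t + 1)) (p : ℕ)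
    [hp : Fact p.Prime] (h : sectionDensity Ψ i p < 1) :
    sectionDensity Ψ i p ≤ ((t : ℝ) + 2) / p := by
  have hp0 : (0 : ℝ) < p := by exact_mod_cast hp.out.pos
  rcases lt_or_ge t p with htp | hpt
  · have hpt' : (t : ℝ) + 1 ≤ p := by exact_mod_cast Nat.succ_le_of_lt htp
    calc sectionDensity Ψ i p ≤ 1 / ((p : ℝ) - t) :=
          DimensionAux.sectionDensity_prime_le_inv Ψ i p h htp
      _ ≤ ((t : ℝ) + 2) / p := by
          rw [div_le_div_iff₀ (by linarith) hp0, one_mul]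
          nlinarith [mul_le_mul_of_nonneg_left hpt' (by positivity : (0 : ℝ) ≤ (t : ℝ) + 1)]
  · have hpt' : (p : ℝ) ≤ t := by exact_mod_cast hpt
    calc sectionDensity Ψ i p ≤ 1 / 2 := DimensionAux.sectionDensity_prime_le_half Ψ i p h
      _ ≤ ((t : ℝ) + 2) / p := by
          rw [div_le_div_iff₀ two_pos hp0, one_mul]
          linarith

/-! ## (b) Off the holes `g(p) ≥ 1/p`; the holes are few -/

/-- **Off the holes, `g(p) ≥ 1/p`.** If the prime `p` does not divide a multiple `Δ` of `|a_i|`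
and of all `|a_i b_k - a_k b_i|` (`k ≠ i`), the root `-b_i/a_i` of `ψ_i` mod `p` is a zero of no
other form (`SingularRatio.exists_root`), so `G = goodCount Ψ p < G' = goodCount Ψ₋ᵢ p ≤ p` and
`g(p) = (G' - G)/G' ≥ 1/G' ≥ 1/p`. -/
theorem inv_le_sectionDensity_of_not_dvd (Ψ : Fin (t + 1) → AffLinForm 1) (i : Fin (t + 1))
    {Δ : ℕ} (hΔa : ((Ψ i).coeff 0).natAbs ∣ Δ)
    (hΔD : ∀ k : Fin t, ((Ψ i).coeff 0 * (Ψ (i.succAbove k)).const -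
      (Ψ (i.succAbove k)).coeff 0 * (Ψ i).const).natAbs ∣ Δ)
    {p : ℕ} (hp : p.Prime) (hpΔ : ¬ p ∣ Δ) : (p : ℝ)⁻¹ ≤ sectionDensity Ψ i p := by
  haveI := Fact.mk hp
  obtain ⟨v, hv, hv'⟩ := SingularRatio.exists_root Ψ i
    (fun h => hpΔ ((Int.natCast_dvd.mp ((ZMod.intCast_zmod_eq_zero_iff_dvd _ p).mp h)).trans hΔa))
    (fun k h => hpΔ ((Int.natCast_dvd.mp ((ZMod.intCast_zmod_eq_zero_iff_dvd _ p).mp h)).trans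
      (hΔD k)))
  have hlt : goodCount Ψ p < goodCount (Fin.removeNth i Ψ) p :=
    SingularRatio.goodCount_lt_removeNth Ψ i p hv hv'
  have hle : goodCount (Fin.removeNth i Ψ) p ≤ p := by
    have h1 : goodCount (Fin.removeNth i Ψ) p ≤ Fintype.card (Fin 1 → ZMod p) :=
      Finset.card_le_univ _
    rwa [card_zmod_pow, pow_one] at h1
  have e1 : (goodCount Ψ p : ℝ) + 1 ≤ goodCount (Fin.removeNth i Ψ) p := by exact_mod_cast hlt
  have e2 : (goodCount (Fin.removeNth i Ψ) p : ℝ) ≤ p := by exact_mod_cast hle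
  have hp0 : (0 : ℝ) < p := by exact_mod_cast hp.pos
  have hG0 : (0 : ℝ) ≤ goodCount Ψ p := Nat.cast_nonneg _
  have hG'0 : (0 : ℝ) < goodCount (Fin.removeNth i Ψ) p := by linarith
  rw [EulerRatioAux.sectionDensity_prime Ψ i, inv_eq_one_div, div_le_div_iff₀ hp0 hG'0, one_mul]
  nlinarith [mul_le_mul_of_nonneg_right
    (by linarith : (1 : ℝ) ≤ goodCount (Fin.removeNth i Ψ) p - goodCount Ψ p) hp0.le]

/-! ## (b) The Mertens window from below, and the holes -/

/-- **Mertens' product theorem with rate, from below**: for `2 ≤ w ≤ z`,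
`(log z/log w)(1 - 50/log w) ≤ (log z/log w) e^{-50/log w} ≤ Π(z)/Π(w)`
(`PairProducts.abs_log_mertensProd_sub_le` twice; the mirror image of
`DimensionAux.mertensProd_div_le`). -/
theorem le_mertensProd_div {w z : ℝ} (hw : 2 ≤ w) (hwz : w ≤ z) :
    Real.log z / Real.log w * (1 - 50 / Real.log w) ≤
      PairProducts.mertensProd z / PairProducts.mertensProd w := by
  have hlogw : 0 < Real.log w := Real.log_pos (by linarith)
  have hlogz : 0 < Real.log z := Real.log_pos (by linarith)
  have hRpos : 0 < PairProducts.mertensProd z / PairProducts.mertensProd w :=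
    div_pos (PairProducts.mertensProd_pos z) (PairProducts.mertensProd_pos w)
  obtain ⟨hz1, -⟩ := abs_le.mp (PairProducts.abs_log_mertensProd_sub_le (le_trans hw hwz))
  obtain ⟨-, hw2⟩ := abs_le.mp (PairProducts.abs_log_mertensProd_sub_le hw)
  have h25 : 25 / Real.log z ≤ 25 / Real.log w :=
    div_le_div_of_nonneg_left (by norm_num) hlogw (Real.log_le_log (by linarith) hwz)
  have hlogR : Real.log (Real.log z) - Real.log (Real.log w) - 50 / Real.log w ≤
      Real.log (PairProducts.mertensProd z / PairProducts.mertensProd w) := by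
    rw [Real.log_div (PairProducts.mertensProd_pos z).ne' (PairProducts.mertensProd_pos w).ne']
    have e50 : (50 : ℝ) / Real.log w = 2 * (25 / Real.log w) := by ring
    linarith
  have hexp : 1 - 50 / Real.log w ≤ Real.exp (-(50 / Real.log w)) := by
    linarith [Real.add_one_le_exp (-(50 / Real.log w))]
  calc Real.log z / Real.log w * (1 - 50 / Real.log w)
      ≤ Real.log z / Real.log w * Real.exp (-(50 / Real.log w)) :=
        mul_le_mul_of_nonneg_left hexp (div_nonneg hlogz.le hlogw.le)
    _ = Real.exp (Real.log (Real.log z) - Real.log (Real.log w) - 50 / Real.log w) := by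
        rw [Real.exp_sub, Real.exp_sub, Real.exp_log hlogz, Real.exp_log hlogw, Real.exp_neg]
        ring
    _ ≤ PairProducts.mertensProd z / PairProducts.mertensProd w :=
        (Real.exp_le_exp.mpr hlogR).trans (Real.exp_log hRpos).le

/-- **Holes and the Mertens window.** For `0 < w ≤ z` and a non-zero multiple `Δ` of `|a_i|` and of
all `|a_i b_k - a_k b_i|`: termwise `(1 - g(p))⁻¹ ≥ (1 - 1/p)⁻¹` off the holes (`g(p) ≥ 1/p`) and
`(1 - g(p))⁻¹ ≥ 1 = (1 - 1/p)⁻¹ (1 - 1/p)` at the holes `p ∣ Δ` (`g(p) ≥ 0`), whence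
`∏_{w ≤ p < z} (1 - g(p))⁻¹ ≥ (Π(z)/Π(w)) ∏_{holes} (1 - 1/p) ≥ (Π(z)/Π(w)) (1 - ω(Δ)/w)`
(Weierstrass' inequality, `1/p ≤ 1/w`, at most `ω(Δ)` holes). -/
theorem mertens_mul_le_prod_window (Ψ : Fin (t + 1) → AffLinForm 1) (i : Fin (t + 1))
    (h : ∀ p : ℕ, p.Prime → sectionDensity Ψ i p < 1) {Δ : ℕ} (hΔ0 : Δ ≠ 0)
    (hΔa : ((Ψ i).coeff 0).natAbs ∣ Δ)
    (hΔD : ∀ k : Fin t, ((Ψ i).coeff 0 * (Ψ (i.succAbove k)).const -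
      (Ψ (i.succAbove k)).coeff 0 * (Ψ i).const).natAbs ∣ Δ)
    {w z : ℝ} (hw : 0 < w) (hwz : w ≤ z) :
    PairProducts.mertensProd z / PairProducts.mertensProd w *
        (1 - (Δ.primeFactors.card : ℝ) / w) ≤
      ∏ p ∈ (Nat.primesBelow ⌈z⌉₊).filter (fun p : ℕ => w ≤ (p : ℝ)),
        (1 - sectionDensity Ψ i p)⁻¹ := by
  set S := (Nat.primesBelow ⌈z⌉₊).filter (fun p : ℕ => w ≤ (p : ℝ)) with hS
  have hmem : ∀ p ∈ S, p.Prime ∧ w ≤ (p : ℝ) := fun p hp => by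
    obtain ⟨h1, h2⟩ := Finset.mem_filter.mp hp
    exact ⟨Nat.prime_of_mem_primesBelow h1, h2⟩
  have hM : ∀ p : ℕ, p.Prime → 0 < 1 - (p : ℝ)⁻¹ := fun p hp =>
    sub_pos.mpr (inv_lt_one_of_one_lt₀ (by exact_mod_cast hp.one_lt))
  -- termwise comparison with the Mertens factors, corrected at the holes
  have hpt : ∀ p ∈ S, (1 - (p : ℝ)⁻¹)⁻¹ * (if p ∣ Δ then 1 - (p : ℝ)⁻¹ else 1) ≤
      (1 - sectionDensity Ψ i p)⁻¹ := by
    intro p hp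
    obtain ⟨hp', -⟩ := hmem p hp
    haveI := Fact.mk hp'
    have hg1 := h p hp'
    by_cases hpd : p ∣ Δ
    · rw [if_pos hpd, inv_mul_cancel₀ (hM p hp').ne']
      exact (one_le_inv₀ (sub_pos.mpr hg1)).mpr
        (sub_le_self 1 (DimensionAux.sectionDensity_prime_nonneg Ψ i p))
    · rw [if_neg hpd, mul_one]
      exact inv_anti₀ (sub_pos.mpr hg1)
        (by linarith [inv_le_sectionDensity_of_not_dvd Ψ i hΔa hΔD hp' hpd])
  have hnonneg : ∀ p ∈ S, 0 ≤ (1 - (p : ℝ)⁻¹)⁻¹ * (if p ∣ Δ then 1 - (p : ℝ)⁻¹ else 1) := by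
    intro p hp
    have h1 := hM p (hmem p hp).1
    refine mul_nonneg (inv_nonneg.mpr h1.le) ?_
    split_ifs
    · exact h1.le
    · exact zero_le_one
  have hprod : ∏ p ∈ S, (1 - (p : ℝ)⁻¹)⁻¹ * (if p ∣ Δ then 1 - (p : ℝ)⁻¹ else 1) =
      PairProducts.mertensProd z / PairProducts.mertensProd w *
        ∏ p ∈ S.filter (fun p => p ∣ Δ), (1 - (p : ℝ)⁻¹) := by
    rw [Finset.prod_mul_distrib, Finset.prod_filter (fun p => p ∣ Δ), hS,
      PairProducts.prod_filter_eq_mertensProd_div hwz]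
  -- the holes: Weierstrass' inequality, `1/p ≤ 1/w`, at most `ω(Δ)` of them
  have hW : 1 - (Δ.primeFactors.card : ℝ) / w ≤
      ∏ p ∈ S.filter (fun p => p ∣ Δ), (1 - (p : ℝ)⁻¹) := by
    have hsub : S.filter (fun p => p ∣ Δ) ⊆ Δ.primeFactors := fun p hp => by
      obtain ⟨hpS, hpd⟩ := Finset.mem_filter.mp hp
      exact Nat.mem_primeFactors.mpr ⟨(hmem p hpS).1, hpd, hΔ0⟩
    have hcard : ((S.filter (fun p => p ∣ Δ)).card : ℝ) ≤ Δ.primeFactors.card := by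
      exact_mod_cast Finset.card_le_card hsub
    have hsum : ∑ p ∈ S.filter (fun p => p ∣ Δ), (p : ℝ)⁻¹ ≤
        (S.filter (fun p => p ∣ Δ)).card / w := by
      calc ∑ p ∈ S.filter (fun p => p ∣ Δ), (p : ℝ)⁻¹
          ≤ ∑ p ∈ S.filter (fun p => p ∣ Δ), w⁻¹ :=
            Finset.sum_le_sum fun p hp => inv_anti₀ hw (hmem p (Finset.mem_filter.mp hp).1).2
        _ = (S.filter (fun p => p ∣ Δ)).card / w := by
            rw [Finset.sum_const, nsmul_eq_mul, div_eq_mul_inv]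
    have hWei := Literature.Barriers.Parity.APSystem.prod_ge_one_sub_sum
      (S.filter (fun p => p ∣ Δ)) (fun p : ℕ => 1 - (p : ℝ)⁻¹) (fun p : ℕ => (p : ℝ)⁻¹)
      (fun p hp => (hM p (hmem p (Finset.mem_filter.mp hp).1).1).le)
      (fun p _ => inv_nonneg.mpr (Nat.cast_nonneg p)) (fun p _ => le_rfl)
    have hdiv : ((S.filter (fun p => p ∣ Δ)).card : ℝ) / w ≤ Δ.primeFactors.card / w :=
      div_le_div_of_nonneg_right hcard hw.le
    linarith
  calc PairProducts.mertensProd z / PairProducts.mertensProd w *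
        (1 - (Δ.primeFactors.card : ℝ) / w)
      ≤ PairProducts.mertensProd z / PairProducts.mertensProd w *
          ∏ p ∈ S.filter (fun p => p ∣ Δ), (1 - (p : ℝ)⁻¹) :=
        mul_le_mul_of_nonneg_left hW
          (div_pos (PairProducts.mertensProd_pos z) (PairProducts.mertensProd_pos w)).le
    _ = ∏ p ∈ S, (1 - (p : ℝ)⁻¹)⁻¹ * (if p ∣ Δ then 1 - (p : ℝ)⁻¹ else 1) := hprod.symm
    _ ≤ ∏ p ∈ S, (1 - sectionDensity Ψ i p)⁻¹ := Finset.prod_le_prod hnonneg hpt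

/-- **The lower window bound at scale `N`.** For `N ≥ 8`, `N ≥ 2L`, `N ≥ L(2L²)^t`, a non-degenerate
system of size `≤ L`, a coordinate with no degenerate prime, and `(log N)² ≤ w ≤ z ≤ 2LN`:
`(log z/log w)(1 - (50 + 4(t+1))/log w) ≤ ∏_{w ≤ p < z} (1 - g(p))⁻¹` (the cross-discriminant `Δ ≠ 0`
has `Δ ≤ N^{t+1}`, so `ω(Δ) ≤ 2(t+1) log N` and `ω(Δ)/w ≤ 2(t+1)/log N ≤ 4(t+1)/log w` as
`log w ≤ log(2LN) ≤ 2 log N`; then `le_mertensProd_div`, `mertens_mul_le_prod_window` and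
`(1 - a)(1 - b) ≥ 1 - a - b`). -/
theorem prod_window_ge (Ψ : Fin (t + 1) → AffLinForm 1) (hΨ : IsNondegenerateSystem Ψ) {L N : ℕ}
    (hL : affLinSize Ψ N ≤ L) (i : Fin (t + 1))
    (hg1 : ∀ p : ℕ, p.Prime → sectionDensity Ψ i p < 1) (hN8 : 8 ≤ N) (hNL : 2 * L ≤ N)
    (hNΔ : L * (2 * L ^ 2) ^ t ≤ N) {w z : ℝ} (hw : Real.log N ^ 2 ≤ w) (hwz : w ≤ z)
    (hz : z ≤ 2 * L * N) :
    Real.log z / Real.log w * (1 - (50 + 4 * ((t : ℝ) + 1)) / Real.log w) ≤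
      ∏ p ∈ (Nat.primesBelow ⌈z⌉₊).filter (fun p : ℕ => w ≤ (p : ℝ)),
        (1 - sectionDensity Ψ i p)⁻¹ := by
  -- the scale
  have hNpos : 0 < N := by omega
  have hNr : (0 : ℝ) < N := by exact_mod_cast hNpos
  have hN8r : (8 : ℝ) ≤ N := by exact_mod_cast hN8
  have hlogN : 2 ≤ Real.log N := by
    rw [Real.le_log_iff_exp_le hNr]
    have h1 := Real.exp_one_lt_d9
    have h2 : Real.exp 2 = Real.exp 1 * Real.exp 1 := by rw [← Real.exp_add]; norm_num
    rw [h2]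
    nlinarith [Real.exp_pos 1]
  have hlogN0 : 0 < Real.log N := by linarith
  have hw2 : 2 ≤ w := by nlinarith
  have hw0 : 0 < w := by linarith
  have hz0 : 0 < z := lt_of_lt_of_le hw0 hwz
  have hlogw : 0 < Real.log w := Real.log_pos (by linarith)
  have hlogwz : Real.log w ≤ Real.log z := Real.log_le_log hw0 hwz
  have hρ0 : 0 ≤ Real.log z / Real.log w := div_nonneg (by linarith) hlogw.le
  have hlogw2 : Real.log w ≤ 2 * Real.log N := by
    have h2L : (2 : ℝ) * L ≤ N := by exact_mod_cast hNL
    have h1 : (2 : ℝ) * L * N ≤ N * N := mul_le_mul_of_nonneg_right h2L hNr.le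
    calc Real.log w ≤ Real.log z := hlogwz
      _ ≤ Real.log ((N : ℝ) * N) := Real.log_le_log hz0 (hz.trans h1)
      _ = 2 * Real.log N := by rw [Real.log_mul hNr.ne' hNr.ne']; ring
  -- the cross-discriminant `Δ ≠ 0`, `Δ ≤ N^{t+1}`
  have hΔ0 := SingularRatio.crossDisc_ne_zero Ψ hΨ i
  have hΔle := SingularRatio.crossDisc_le Ψ hNpos hL i
  set Δ : ℕ := ((Ψ i).coeff 0).natAbs * ∏ k : Fin t, ((Ψ i).coeff 0 * (Ψ (i.succAbove k)).const -
      (Ψ (i.succAbove k)).coeff 0 * (Ψ i).const).natAbs with hΔdef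
  have hΔa : ((Ψ i).coeff 0).natAbs ∣ Δ := Dvd.intro _ rfl
  have hΔD : ∀ k : Fin t, ((Ψ i).coeff 0 * (Ψ (i.succAbove k)).const -
      (Ψ (i.succAbove k)).coeff 0 * (Ψ i).const).natAbs ∣ Δ := fun k =>
    (Finset.dvd_prod_of_mem _ (Finset.mem_univ k)).mul_left _
  have hΔN : Δ ≤ N ^ (t + 1) := by
    calc Δ ≤ L * (2 * L ^ 2 * N) ^ t := hΔle
      _ = L * (2 * L ^ 2) ^ t * N ^ t := by rw [mul_pow, mul_assoc]
      _ ≤ N * N ^ t := Nat.mul_le_mul_right _ hNΔ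
      _ = N ^ (t + 1) := by rw [pow_succ, mul_comm]
  -- `ω(Δ) ≤ 2(t+1) log N` and the hole density `ω(Δ)/w ≤ 4(t+1)/log w`
  have hω : (Δ.primeFactors.card : ℝ) ≤ 2 * ((t : ℝ) + 1) * Real.log N := by
    -- `2^{ω(Δ)} ≤ ∏_{p ∣ Δ} p ≤ Δ ≤ N^{t+1}` (as `SharpGY.card_primeFactors_mul_log_two_le` of
    -- `GreenTao2008SharpGYDiagonal.lean`, inlined to keep the import closure of the line small)
    have h0 : 2 ^ Δ.primeFactors.card ≤ Δ :=
      (Finset.pow_card_le_prod Δ.primeFactors (fun p => p) 2 fun p hp =>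
          (Nat.prime_of_mem_primeFactors hp).two_le).trans
        (Nat.le_of_dvd (Nat.pos_of_ne_zero hΔ0) (Nat.prod_primeFactors_dvd Δ))
    have h1 : (Δ.primeFactors.card : ℝ) * Real.log 2 ≤ ((t : ℝ) + 1) * Real.log N := by
      have h3 : (2 : ℝ) ^ Δ.primeFactors.card ≤ (N : ℝ) ^ (t + 1) := by
        exact_mod_cast h0.trans hΔN
      have h4 := Real.log_le_log (by positivity) h3
      rw [Real.log_pow, Real.log_pow] at h4
      push_cast at h4
      exact h4
    have hl2 := Real.log_two_gt_d9
    have hω0 : (0 : ℝ) ≤ Δ.primeFactors.card := Nat.cast_nonneg _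
    have ht0 : (0 : ℝ) ≤ t := Nat.cast_nonneg t
    nlinarith [mul_le_mul_of_nonneg_left hl2.le hω0, mul_nonneg ht0 hlogN0.le, hlogN0.le]
  have hb : (Δ.primeFactors.card : ℝ) / w ≤ 4 * ((t : ℝ) + 1) / Real.log w := by
    have hlogN2 : (0 : ℝ) < Real.log N ^ 2 := by positivity
    calc (Δ.primeFactors.card : ℝ) / w ≤ Δ.primeFactors.card / Real.log N ^ 2 :=
          div_le_div_of_nonneg_left (Nat.cast_nonneg _) hlogN2 hw
      _ ≤ 2 * ((t : ℝ) + 1) * Real.log N / Real.log N ^ 2 := div_le_div_of_nonneg_right hω hlogN2.le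
      _ = 2 * ((t : ℝ) + 1) / Real.log N := by rw [sq, mul_div_mul_right _ _ hlogN0.ne']
      _ ≤ 4 * ((t : ℝ) + 1) / Real.log w := by
          rw [div_le_div_iff₀ hlogN0 hlogw]
          nlinarith [mul_le_mul_of_nonneg_left hlogw2 (by positivity : (0 : ℝ) ≤ 2 * ((t : ℝ) + 1))]
  -- Mertens from below and the holes
  have hP := le_mertensProd_div hw2 hwz
  have hA := mertens_mul_le_prod_window Ψ i hg1 hΔ0 hΔa hΔD hw0 hwz
  have hP0 : 0 < PairProducts.mertensProd z / PairProducts.mertensProd w :=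
    div_pos (PairProducts.mertensProd_pos z) (PairProducts.mertensProd_pos w)
  have hprod0 : 0 ≤ ∏ p ∈ (Nat.primesBelow ⌈z⌉₊).filter (fun p : ℕ => w ≤ (p : ℝ)),
      (1 - sectionDensity Ψ i p)⁻¹ :=
    Finset.prod_nonneg fun p hp => inv_nonneg.mpr (sub_nonneg.mpr
      (hg1 p (Nat.prime_of_mem_primesBelow (Finset.mem_filter.mp hp).1)).le)
  -- the final algebra: `(1 - a)(1 - b) ≥ 1 - a - b`
  have hsplit : 1 - (50 + 4 * ((t : ℝ) + 1)) / Real.log w =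
      1 - 50 / Real.log w - 4 * ((t : ℝ) + 1) / Real.log w := by
    rw [add_div]
    ring
  have ha0 : 0 ≤ 50 / Real.log w := by positivity
  have hb0 : 0 ≤ 4 * ((t : ℝ) + 1) / Real.log w := by positivity
  rw [hsplit]
  rcases le_or_gt (1 - 50 / Real.log w - 4 * ((t : ℝ) + 1) / Real.log w) 0 with hneg | hpos
  · exact (mul_nonpos_of_nonneg_of_nonpos hρ0 hneg).trans hprod0
  · have h1b : 0 ≤ 1 - 4 * ((t : ℝ) + 1) / Real.log w := by linarith
    calc Real.log z / Real.log w * (1 - 50 / Real.log w - 4 * ((t : ℝ) + 1) / Real.log w)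
        ≤ Real.log z / Real.log w * (1 - 50 / Real.log w) *
            (1 - 4 * ((t : ℝ) + 1) / Real.log w) := by
          nlinarith [mul_nonneg hρ0 (mul_nonneg ha0 hb0)]
      _ ≤ PairProducts.mertensProd z / PairProducts.mertensProd w *
            (1 - 4 * ((t : ℝ) + 1) / Real.log w) := mul_le_mul_of_nonneg_right hP h1b
      _ ≤ PairProducts.mertensProd z / PairProducts.mertensProd w *
            (1 - (Δ.primeFactors.card : ℝ) / w) := mul_le_mul_of_nonneg_left (by linarith) hP0.le
      _ ≤ _ := hA

end DimensionLowAux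

open DimensionLowAux in
/-- **`stub_sectionDimensionLow`** (registered stub of the line `section-annihilator`, skeleton v13):
`SectionDimensionLow` — with `L₁ = 50 + 4(t+1)` and `N₀ = 8 + 2L + L(2L²)^t`, for `N ≥ N₀`, every
non-degenerate `(t+1)`-form system of size `≤ L` and every coordinate `i` with `g(p) < 1` at all primes:
(a) `g(p) ≤ (t+2)/p` at every prime; (b) `∏_{w ≤ p < z} (1 - g(p))⁻¹ ≥ (log z/log w)(1 - L₁/log w)`
for `(log N)² ≤ w ≤ z ≤ 2LN` (off the `ω(Δ) ≪ log N` holes `g(p) ≥ 1/p`; Weierstrass; Mertens'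
product theorem with rate). -/
theorem stub_sectionDimensionLow : SectionDimensionLow := by
  intro t L
  refine ⟨50 + 4 * ((t : ℝ) + 1), 8 + 2 * L + L * (2 * L ^ 2) ^ t,
    fun N hN Ψ hΨ hL i hg1 => ⟨fun p hp => ?_, fun w z hw hwz hz => ?_⟩⟩
  · haveI := Fact.mk hp
    exact sectionDensity_prime_le_div Ψ i p (hg1 p hp)
  · have hN8 : 8 ≤ N := le_trans (by omega) hN
    have hNL : 2 * L ≤ N := le_trans (by omega) hN
    have hNΔ : L * (2 * L ^ 2) ^ t ≤ N := le_trans (by omega) hN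
    exact prod_window_ge Ψ hΨ hL i hg1 hN8 hNL hNΔ hw hwz hz

end Summit.Parity.GeneralizedHardyLittlewood.Cruxes.CellParityLaw.SectionAnnihilator

end
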